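import Summits.BirchSwinnertonDyer.BirchSwinnertonDyer.Theorems.ManinLocalTwoThreeManinPrimeToAdditiveFiveLeOrdinaryCornerNotBottomOfOrdinaryTwistLaws
import HarnessLib

/-!
# Route `ManinLocalTwoThree`, residual crux C5 `ManinPrimeToAdditiveFiveLe`
# (stmt-BirchSwinnertonDyer-22969), line `upper_anchor` (skeleton v11: `stub_ord57` := 27552,
# `stub_ordinaryTwistLaw13` := E-imc-9(13) BY NAME): **«never BOTTOM» at EVERY `p ≥ 5` from E-imc-9 — generic form
# of ω, and C1 `EisensteinOrdinaryTwistLatticeNotBottom` (stmt-25939, `p ≥ 11`) ⟸ Modularity ∧ E-imc-9(p ≥ 11)**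

Width seat bsd-line-ml23-c5-p1-w3 (gen 0), piece ω2 (sequel of ω, `…OrdinaryCornerNotBottomOfOrdinaryTwistLaws.lean`:
K18b stmt-27558 ⟸ Modularity ∧ E-imc-9(5, 7)). The ω argument is uniform in `p`: for every prime `p ≥ 5`,
E-imc-9 `OrdinaryRamifiedTwistLaw p` + modularity put the lattice-optimal datum of an unstarred additive curve with
tame index `e ∣ p − 1` in configuration TOP, never BOTTOM, with respect to the ramified quadratic twist. Route
`TwistFamilyManinDescent` carries the `p ≥ 11` statement as its own crux C1 `EisensteinOrdinaryTwistLatticeNotBottom`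
(stmt-BirchSwinnertonDyer-25939: `p ≥ 11`, additive, `W[p]` reducible, (G)-ordinary, `ord_p Δ_min ≤ 4`,
lattice-optimal ⟹ NOT `g(χ) Λ(f ⊗ χ) ⊆ p Λ(f)`), the parent of K18b. THIS FILE proves:

* §1 `twistLattice_not_bottom_of_ordinaryRamifiedTwistLaw` — **generic ω**: `p ≥ 5` prime, E-imc-9(p),
  modularity, `W` globally minimal with lattice-optimal conductor-level `D`, `p² ∣ N(W)`, `ord_p Δ_min(W) ≤ 4`,
  `e ∣ p − 1`, `χ` quadratic primitive mod `p` ⟹ NOT BOTTOM. (Proof = ω §3 verbatim at a general `p`.)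
* §2 `eisensteinOrdinaryTwistLatticeNotBottom_of_ordinaryRamifiedTwistLaws` — **C1 (stmt-25939) BY NAME ⟸
  `exists_isNewformOf` ∧ `∀ p ≥ 11, OrdinaryRamifiedTwistLaw p`**; the (G)-ordinary binder supplies `e ∣ p − 1`
  (`subGord_of_typeGOrd_of_addv`), the reducibility binder is idle. At `p = 13` the input is v11's
  `stub_ordinaryTwistLaw13` (E-imc-9(13)) by name.

HONEST STATUS. Conditional results (`--supports` the C5 crux as a helper): E-imc-9 is an OPEN conjecture of the
cell; C1 / K18b stay open unconditionally. Nothing here proves 27552, C5, Manin's conjecture or BSD.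

References: [EdixhovenManin1991] §4; [Stevens1989] (5.4)–(5.5); [ZagierCMB1985] §1; [DiamondShurman2005] §5.8,
Thm. 8.8.3; cell bsd-f2-manin MEMO-imc.md §10 (E-imc-9); route TwistFamilyManinDescent LINE 10/18 (25939, 27558).
-/

set_option autoImplicit false
-- the Theorems namespace of this sub repeats the summit name by design (D-0017 nested layout)
set_option linter.dupNamespace false

noncomputable section

open scoped Classical NumberField

namespace Summit.BirchSwinnertonDyer.BirchSwinnertonDyer.Theorems

open WeierstrassCurve IsDedekindDomain IsDedekindDomain.HeightOneSpectrum Rat.HeightOneSpectrum NumberField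
  Literature.NumberTheory.EllipticCurves Literature.NumberTheory.EllipticCurves.ModularForms
  Literature.NumberTheory.EllipticCurves.Rank1Residual
  Literature.NumberTheory.DiophantineGeometry
  Summit.BirchSwinnertonDyer.Rank1Residual.ManinAdditive
  Summit.BirchSwinnertonDyer.Rank1Residual.Additive

/-! ## §1 Generic ω: never BOTTOM on an unstarred `e ∣ p − 1` row, from E-imc-9(p) -/

/-- **Generic ω (every prime `p ≥ 5`).** Granted modularity and E-imc-9 `OrdinaryRamifiedTwistLaw p`: for `W`
globally minimal with a lattice-optimal conductor-level datum `D`, `p² ∣ N(W)`, `ord_p Δ_min(W) ≤ 4` and tame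
index `e ∣ p − 1`, and `χ` the quadratic primitive character mod `p`, the twisted period lattice is NOT at the
bottom: `¬ (g(χ) · Λ(f ⊗ χ) ⊆ p · Λ(f))`. Proof as in ω §3 (Legendre uniqueness, no `Iₙ*` ⟹ twist additive,
χ-packet twin with `deg₀ = p·deg`, index engine `m = 1 ⟹ m′ = p²`, twin's newform `= f ⊗ χ`, BOTTOM ⟹ `m′ = 1`).
Conditional result; closes nothing. [cite: Stevens1989, (5.4)–(5.5)] [cite: ZagierCMB1985, §1]
[cite: EdixhovenManin1991, §4] -/
theorem twistLattice_not_bottom_of_ordinaryRamifiedTwistLaw (hnf : exists_isNewformOf) {p : ℕ} [Fact p.Prime]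
    (h5 : 5 ≤ p) (hO : OrdinaryRamifiedTwistLaw p)
    (W : WeierstrassCurve ℚ) [W.IsElliptic] [W.IsGloballyMinimal] [NeZero (W.conductorNorm ℤ)]
    (D : ModularParametrizationData W (W.conductorNorm ℤ)) (hsq : p ^ 2 ∣ W.conductorNorm ℤ)
    (hv4 : padicValInt p W.minimalDiscriminantInt ≤ 4)
    (he : 12 / Nat.gcd 12 (padicValInt p W.minimalDiscriminantInt) ∣ p - 1)
    (hD : ∀ z ∈ D.L.lattice, ∃ w ∈ periodLattice D.f, z = D.c * w)
    (χ : DirichletCharacter ℂ p) (hχ : χ.IsQuadratic) (hprim : χ.IsPrimitive) :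
    ¬ (∀ w ∈ periodLattice (charTwist (W.conductorNorm ℤ) (dvd_refl _) hsq hχ D.f),
        ∃ y ∈ periodLattice D.f, gaussSum χ (ZMod.stdAddChar (N := p)) * w = (p : ℂ) * y) := by
  intro hbottom
  have hp : p.Prime := Fact.out
  have hp2 : p ≠ 2 := by omega
  obtain rfl := dirichletCharacter_eq_quadraticChar_of_isQuadratic_of_isPrimitive hp2 χ hχ hprim
  have hadd : Addv W p := not_good_and_not_mult_of_sq_dvd_conductorNorm W hsq
  -- no `Iₙ*` fibre (`ord_p Δ_min ≤ 4`), hence `W ⊗ p*` is additive at `(p)`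
  have hI : ∀ n : ℕ, W.kodairaSymbolAt ((Rat.HeightOneSpectrum.primesEquiv (R := ℤ)).symm ⟨p, hp⟩) ≠ .Istar n := by
    intro n hn
    have hn' : W.kodairaSymbolAt (placeOf p) = .Istar n := hn
    rcases kodairaSymbolAt_placeOf_cases_of_addv W p h5 hadd with
      ⟨hk, -⟩ | ⟨hk, -⟩ | ⟨hk, -⟩ | ⟨m, -, hv⟩ | ⟨-, hv⟩ | ⟨-, hv⟩ | ⟨-, hv⟩
    · rw [hn'] at hk; cases hk
    · rw [hn'] at hk; cases hk
    · rw [hn'] at hk; cases hk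
    all_goals omega
  have htwadd := twist_pStar_additiveAt_of_forall_ne_Istar W hp hp2 hI
  -- the χ-packet: the commuting lattice-optimal starred twin
  obtain ⟨W₀, hE₀, hM₀, hne₀, u, D₀, hD₀, hu, hiso, -, hNN, hpN₀, hup, -, -⟩ :=
    exists_commuting_starred_twin_of_twistAdditive_of_ordinaryRamifiedTwistLaw hnf hp h5 hO W D hD hsq htwadd hv4 he
  haveI := hE₀
  haveI := hM₀
  haveI := hne₀
  -- the Gauss sum of the Legendre symbol
  set G : ℂ := gaussSum ((quadraticChar (ZMod p)).ringHomComp (Int.castRingHom ℂ))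
    (ZMod.stdAddChar (N := p)) with hGdef
  set ε : ℤ := (-1 : ℤ) ^ (p / 2) with hεdef
  have hε2 : (ε : ℂ) * ε = 1 := by
    rw [hεdef]; push_cast
    rw [← pow_add, ← two_mul, pow_mul, neg_one_sq, one_pow]
  have hG2 : G ^ 2 = (ε : ℂ) * (p : ℂ) := by
    rw [hGdef, gaussSum_quadraticChar_ringHomComp_sq p hp2, hεdef]
    push_cast
    ring
  have hG0 : G ≠ 0 := by
    intro h0
    have : (ε : ℂ) * (p : ℂ) = 0 := by rw [← hG2, h0]; simp
    rcases mul_eq_zero.mp this with h | h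
    · have : (ε : ℂ) * ε = 0 := by rw [h, zero_mul]
      rw [hε2] at this; exact one_ne_zero this
    · exact hp.ne_zero (by exact_mod_cast h)
  have ha : ‖G‖ ^ 2 = p := by
    rw [← norm_pow, hG2, norm_mul, hεdef]
    push_cast
    rw [norm_pow, norm_neg, norm_one, one_pow, one_mul, Complex.norm_natCast]
  -- the index engine on the commuting pair: `m · m′ = p²`, `m · deg₀ = p · deg`
  obtain ⟨h1, h2, hcoef⟩ := pStar_orbit_steps hp2 D D₀ hsq hNN hiso
  have hc₀ : (D₀.c : ℂ) ≠ 0 := by exact_mod_cast D₀.maninConstant_ne_zero_holds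
  have hc₁ : (D.c : ℂ) ≠ 0 := by exact_mod_cast D.maninConstant_ne_zero_holds
  have ht : (D.c : ℂ) * G / (D₀.c : ℂ) ≠ 0 := div_ne_zero (mul_ne_zero hc₁ hG0) hc₀
  have ht' : (D₀.c : ℂ) * G / (D.c : ℂ) ≠ 0 := div_ne_zero (mul_ne_zero hc₀ hG0) hc₁
  obtain ⟨hmm, hmdeg⟩ := optimal_orbit_index_engine hNN D D₀ hD hD₀ ha h1 h2 hcoef ht ht'
  -- `deg₀ = p · deg` forces `m = 1`, hence `m′ = p²`
  have hpos : 0 < D₀.modularDegree := D₀.deg_pos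
  have hm1 : (D₀.L.mulLeft _ ht).lattice.toAddSubgroup.relIndex D.L.lattice.toAddSubgroup = 1 := by
    refine Nat.eq_of_mul_eq_mul_right hpos ?_
    rw [one_mul, hmdeg, hup]
  rw [hm1, one_mul] at hmm
  -- BOTTOM would force `m′ = 1`: the twin's newform is `f ⊗ χ`, and `Λ(f ⊗ χ) ⊆ (p / G) Λ(f) = ε G Λ(f)`
  obtain ⟨hng₀, hnm₀⟩ := not_good_and_not_mult_of_sq_dvd_conductorNorm W₀ hpN₀
  have hW₀0 : ∀ n : ℕ, p ∣ n → W₀.LFunction n = 0 := fun n hn ↦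
    W₀.LFunction_apply_eq_zero_of_not_good_of_not_mult p hng₀ hnm₀ hn
  have hcoef₀ : ∀ n : ℕ, cuspCoeff D₀.f n =
      (quadraticChar (ZMod p)).ringHomComp (Int.castRingHom ℂ) n * cuspCoeff D.f n := fun n ↦
    cuspCoeff_eq_chi_mul_of_twist_pStar hp2 u hu rfl hW₀0 D D₀ n
  have hχp := isPrimitive_quadraticChar_ringHomComp p hp2
  have hΛ : periodLattice (charTwist (W.conductorNorm ℤ) (dvd_refl _) hsq hχ D.f) = periodLattice D₀.f :=
    periodLattice_eq_of_level_eq_of_cuspCoeff_eq hNN.symm _ _ fun n ↦ by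
      rw [cuspCoeff_charTwist _ (dvd_refl _) hsq hχ hχp D.f n, hcoef₀ n]
  have hle : D₀.L.lattice.toAddSubgroup ≤ (D.L.mulLeft _ ht').lattice.toAddSubgroup := by
    intro z hz
    obtain ⟨w₀, hw₀, rfl⟩ := hD₀ z hz
    rw [← hΛ] at hw₀
    obtain ⟨y, hy, hGw⟩ := hbottom w₀ hw₀
    -- `w₀ = ε G y`
    have hw : w₀ = (ε : ℂ) * G * y := by
      refine mul_left_cancel₀ hG0 ?_
      rw [hGw]
      linear_combination (-(ε : ℂ) * y) * hG2 + (-(p : ℂ) * y) * hε2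
    have hεy : (ε : ℂ) * y ∈ periodLattice D.f := by
      rcases neg_one_pow_eq_or ℤ (p / 2) with h | h
      · rw [hεdef, h]; push_cast; rw [one_mul]; exact hy
      · rw [hεdef, h]; push_cast; rw [neg_one_mul]; exact neg_mem hy
    change (D₀.c : ℂ) * w₀ ∈ (D.L.mulLeft _ ht').lattice
    rw [PeriodPair.mem_mulLeft_lattice]
    have key : ((D₀.c : ℂ) * G / (D.c : ℂ))⁻¹ * ((D₀.c : ℂ) * w₀) = (D.c : ℂ) * ((ε : ℂ) * y) := by
      rw [hw]; field_simp
    rw [key]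
    exact D.smul_periodLattice_le _ hεy
  have hm'1 : (D.L.mulLeft _ ht').lattice.toAddSubgroup.relIndex D₀.L.lattice.toAddSubgroup = 1 :=
    AddSubgroup.relIndex_eq_one.mpr hle
  rw [hm'1] at hmm
  -- `1 = p²`
  have : p ^ 2 = 1 := by exact_mod_cast hmm.symm
  nlinarith [hp.two_le]

/-! ## §2 C1 `EisensteinOrdinaryTwistLatticeNotBottom` (stmt-25939) from E-imc-9 at `p ≥ 11` -/

/-- **C1 `TwistFamilyManinDescent.EisensteinOrdinaryTwistLatticeNotBottom` (stmt-BirchSwinnertonDyer-25939) BY NAME ⟸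
Modularity ∧ E-imc-9 `OrdinaryRamifiedTwistLaw p` for every prime `p ≥ 11`.** The (G)-ordinary binder of C1 gives
`e ∣ p − 1` (`subGord_of_typeGOrd_of_addv`); §1 does the rest; the reducibility binder is idle. Conditional result;
closes nothing. [cite: EdixhovenManin1991, §4] [cite: Stevens1989, (5.4)–(5.5)] -/
theorem eisensteinOrdinaryTwistLatticeNotBottom_of_ordinaryRamifiedTwistLaws (hnf : exists_isNewformOf)
    (hO : ∀ p : ℕ, p.Prime → 11 ≤ p → OrdinaryRamifiedTwistLaw p) :
    Summit.BirchSwinnertonDyer.BirchSwinnertonDyer.Theses.TwistFamilyManinDescent.EisensteinOrdinaryTwistLatticeNotBottom := by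
  intro W _ _ p _ _ D hsq h11 hadd _hred hG hv4 hD χ hχ hprim
  have hp : p.Prime := Fact.out
  have hp2 : p ≠ 2 := by omega
  have he : 12 / Nat.gcd 12 (padicValInt p W.minimalDiscriminantInt) ∣ p - 1 :=
    (subGord_of_typeGOrd_of_addv W p hp2 hG hadd).2.2
  exact twistLattice_not_bottom_of_ordinaryRamifiedTwistLaw hnf (by omega) (hO p hp h11) W D hsq hv4 he hD χ hχ hprim

end Summit.BirchSwinnertonDyer.BirchSwinnertonDyer.Theorems

end
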